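import Mathlib.Analysis.Complex.Basic
import Mathlib.Geometry.Manifold.VectorBundle.Hom
import Mathlib.Geometry.Manifold.VectorBundle.ContMDiffSection
import Mathlib.LinearAlgebra.Determinant
import Literature.Geometry.Kaehler.ManifoldForms
import HarnessLib

/-!
# Almost complex structures on real manifolds; `ω`-tame and `ω`-compatible structures

Topic `Literature/Geometry/Symplectic` (definition request `defn-AlmostComplexStructure` of route
`SmoothPoincare4/TwistorRealLines`: the vocabulary of its cruxes *RealCongruenceRigidity* and
*TwistorToStandard* — smooth `ω`-tame almost complex structures `J` on `ℂP³`, `τ₀`-real `J`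
(`dτ₀ ∘ J = -J ∘ dτ₀`), `J`-complex fibres `J (ker dp) = ker dp`).

## Main definitions

* `Literature.Geometry.Symplectic.AlmostComplexStructure I n M`: a `C^n` almost complex structure
  on a real manifold `M` modelled on `I : ModelWithCorners ℝ E H` — a `C^n` section `J` of the
  endomorphism bundle `End(TM)` (Mathlib's hom-bundle `fun x ↦ TangentSpace I x →L[ℝ]
  TangentSpace I x`, `Bundle.ContinuousLinearMap`, smoothness spelled exactly as for Mathlib's
  `Bundle.ContMDiffRiemannianMetric`) with `J x (J x v) = -v`. McDuff–Salamon (2017), §4.1: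
  `𝒥(M) := {J ∈ C^∞(M, End(TM)) | J² = -1}`. Coerces to `(x : M) → T_x M →L[ℝ] T_x M`.
* `AlmostComplexStructure.IsTamedBy J σ` (`σ` a `2`-form, `Literature.Geometry.Kaehler.MForm I M ℝ 2`):
  `σ(v, Jv) > 0` for `v ≠ 0` (McDuff–Salamon (2017), (4.1.1));
  `AlmostComplexStructure.IsCompatibleWith J σ`: tame and `σ(Jv, Jw) = σ(v, w)` ((4.1.2)).
* Examples: `AlmostComplexStructure.ofModel I n J₀ h` (a constant linear complex structure `J₀` on
  the model space `H`), `AlmostComplexStructure.standard n E` (`J₀ = i • id` on a complex normed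
  space `E = ℂⁿ`, McDuff–Salamon (2017), §2.5), the conjugate structure `-J`.

Companion files (same topic): `AlmostComplexStructureMaps.lean` — part (c) of the request:
`(J, J')`-holomorphic and anti-holomorphic maps (`df ∘ J = ± J' ∘ df`, McDuff–Salamon (2017),
§4.5 (4.5.1); e.g. a real structure `τ`, `dτ ∘ J = -J ∘ dτ`) and `J`-complex subspaces
`J V ⊆ V ⊆ T_x M` (e.g. `ker dp` for a fibration with `J`-complex fibres);
`AlmostComplexStructureOfComplex.lean` — the almost complex structure `i • id` of a complex
manifold (`Literature.Geometry.Kaehler.tangentJ` as an `AlmostComplexStructure 𝓘(ℝ, E) ∞ M`), its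
compatibility with the Kähler form of a Hermitian metric, and "holomorphic ⇒ `J`-holomorphic".

## API

`J x` is a linear isomorphism (`toContinuousLinearEquiv`, inverse `-J x`); an almost complex
manifold has even dimension (`even_finrank`, McDuff–Salamon (2017), §2.5/§4.1); regularity
weakening `ofLE`; the conjugate structure `-J` (`instNeg`, an involution); compatible ⇒ tame,
tame ⇒ `σ` nondegenerate (`IsTamedBy.eq_zero_of_forall`), `J` is `σ`-skew for a compatible pair
(`IsCompatibleWith.map_left`), compatible ⇔ `g_J(v, w) := σ(v, Jw)` symmetric and positive
definite (`isCompatibleWith_iff`, McDuff–Salamon (2017), (4.1.3)); `-J` is tamed by / compatible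
with `-σ`.

## Mathlib / Literature status

Mathlib (pinned v4.32.0) has complex manifolds (`Mathlib.Geometry.Manifold.Complex`), the hom
bundle of `C^n` vector bundles and Riemannian metrics as smooth sections of a hom bundle, but no
almost complex structures (`lean search 'AlmostComplex|IsTamedBy'`: no hit). In this tree,
`Literature.Geometry.Symplectic.SteinStructure` carries an ad-hoc field `J` on compact
`4`-manifolds with boundary (smoothness as "maps smooth vector fields to smooth vector fields"),
and `Literature.Geometry.Kaehler.tangentJ` is the operator `i • id` on the real tangent spaces of
a *complex* manifold; neither is a general notion on a real manifold. The bridge "a complex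
manifold carries the almost complex structure `tangentJ`" (via
`Literature.Geometry.Kaehler.symmL_trivializationAt_I_smul`) is deliberately left to a separate
file so that this one does not import the Kähler/Riemannian material.

## Design notes

* The smoothness exponent `n : WithTop ℕ∞` is a parameter (the theory of `J`-holomorphic curves
  works with `C^ℓ` structures; the route uses `n = ∞`); the base needs only `[IsManifold I 1 M]`
  (for the tangent bundle to be a vector bundle), found by instance from `[IsManifold I ∞ M]`.
* Forms are named `σ` (`ω` is a reserved token under `open scoped ContDiff`).
* Deliberately NOT here: (anti-)holomorphic maps and `J`-complex subspaces (companion file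
  `AlmostComplexStructureMaps.lean`), complex manifolds (`AlmostComplexStructureOfComplex.lean`),
  integrability / the Nijenhuis tensor, first Chern class, existence and contractibility of
  `𝒥(M, ω)` (McDuff–Salamon (2017), Prop. 4.1.1), the standard structure of
  `Literature.Topology.FourManifolds.ComplexProjectiveSpace n` (charted on `ℝ²ⁿ`, not a Mathlib
  complex manifold) and its tameness by the Fubini–Study form (needs the Fubini–Study `MForm`,
  request `defn-FubiniStudyMFormProjectiveSpace`), pull-back of `J` along diffeomorphisms.

## References

* D. McDuff, D. Salamon, *Introduction to Symplectic Topology*, 3rd ed. (2017), §2.5 (linear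
  complex structures), §4.1 (almost complex structures, (4.1.1)–(4.1.3)), §4.5 ((4.5.1),
  `J`-holomorphic curves). [McDuffSalamon2017]
* D. McDuff, D. Salamon, *J-holomorphic Curves and Symplectic Topology*, 2nd ed. (2012), §2.1,
  §3.1 (`C^ℓ` structures `𝒥^ℓ`). [McDuffSalamon2012]
-/

noncomputable section

open scoped Manifold ContDiff Topology
open Bundle Set Function

namespace Literature.Geometry.Symplectic

variable {E : Type*} [NormedAddCommGroup E] [NormedSpace ℝ E] {H : Type*} [TopologicalSpace H]
  (I : ModelWithCorners ℝ E H) (n : WithTop ℕ∞) (M : Type*) [TopologicalSpace M]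
  [ChartedSpace H M] [IsManifold I 1 M]

/-- A **`C^n` almost complex structure** on the real manifold `M` (modelled on
`I : ModelWithCorners ℝ E H`): a family of continuous linear endomorphisms `J x` of the tangent
spaces `TangentSpace I x` with `J x (J x v) = -v`, which is a `C^n` section of the endomorphism
bundle `End(TM)` (Mathlib's hom bundle `fun x ↦ TangentSpace I x →L[ℝ] TangentSpace I x` with
model fibre `E →L[ℝ] E`). McDuff–Salamon (2017), §4.1: "an automorphism `J : TM → TM` of the
tangent bundle such that `J² = -1`", `𝒥(M) := {J ∈ C^∞(M, End(TM)) | J² = -1}`; the regularity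
`n` is a parameter (`𝒥^ℓ`, McDuff–Salamon (2012), §3.1). [cite: McDuffSalamon2017, §4.1] -/
structure AlmostComplexStructure where
  /-- the endomorphism `J x : T_x M →L[ℝ] T_x M` -/
  toFun (x : M) : TangentSpace I x →L[ℝ] TangentSpace I x
  /-- `J² = -1` -/
  map_map' (x : M) (v : TangentSpace I x) : toFun x (toFun x v) = -v
  /-- `J` is a `C^n` section of `End(TM)` -/
  contMDiff' : ContMDiff I (I.prod 𝓘(ℝ, E →L[ℝ] E)) n
    (fun x ↦ TotalSpace.mk' (E →L[ℝ] E)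
      (E := fun x : M ↦ TangentSpace I x →L[ℝ] TangentSpace I x) x (toFun x))

namespace AlmostComplexStructure

variable {I n M}

/-- An almost complex structure is applied to points: `J x : T_x M →L[ℝ] T_x M`. [folklore] -/
instance instDFunLike :
    DFunLike (AlmostComplexStructure I n M) M
      (fun x ↦ TangentSpace I x →L[ℝ] TangentSpace I x) where
  coe := toFun
  coe_injective := by
    rintro ⟨J₁, h₁, c₁⟩ ⟨J₂, h₂, c₂⟩ (h : J₁ = J₂)
    subst h
    rfl

/-- The structure field `toFun` is the coercion. [folklore] -/
@[simp] theorem toFun_eq_coe (J : AlmostComplexStructure I n M) : J.toFun = ⇑J := rfl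

/-- Two almost complex structures agreeing on every tangent vector are equal. [folklore] -/
@[ext]
theorem ext {J J' : AlmostComplexStructure I n M} (h : ∀ x v, J x v = J' x v) : J = J' :=
  DFunLike.ext J J' fun x ↦ ContinuousLinearMap.ext (h x)

/-- `J² = -1`: `J x (J x v) = -v` (McDuff–Salamon (2017), §4.1). [cite: McDuffSalamon2017, §4.1] -/
@[simp]
protected theorem map_map (J : AlmostComplexStructure I n M) (x : M) (v : TangentSpace I x) :
    J x (J x v) = -v :=
  J.map_map' x v

/-- `J x ∘ J x = -id` (McDuff–Salamon (2017), §4.1). [cite: McDuffSalamon2017, §4.1] -/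
theorem comp_self (J : AlmostComplexStructure I n M) (x : M) :
    (J x).comp (J x) = -ContinuousLinearMap.id ℝ (TangentSpace I x) := by
  ext v
  simp

/-- `J` is a `C^n` section of the endomorphism bundle `End(TM)` (McDuff–Salamon (2017), §4.1:
`J ∈ C^∞(M, End(TM))`). [cite: McDuffSalamon2017, §4.1] -/
protected theorem contMDiff (J : AlmostComplexStructure I n M) :
    ContMDiff I (I.prod 𝓘(ℝ, E →L[ℝ] E)) n
      (fun x ↦ TotalSpace.mk' (E →L[ℝ] E)
        (E := fun x : M ↦ TangentSpace I x →L[ℝ] TangentSpace I x) x (J x)) :=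
  J.contMDiff'

/-- `J x` is injective (it squares to `-1`). [folklore] -/
theorem injective (J : AlmostComplexStructure I n M) (x : M) : Injective (J x) := by
  intro v w h
  have h' := congrArg (J x) h
  simpa using h'

/-- `J x` is surjective: `v = J x (-(J x v))`. [folklore] -/
theorem surjective (J : AlmostComplexStructure I n M) (x : M) : Surjective (J x) :=
  fun v ↦ ⟨-J x v, by simp⟩

/-- `J x v = 0 ↔ v = 0`. [folklore] -/
@[simp]
theorem map_eq_zero_iff (J : AlmostComplexStructure I n M) (x : M) {v : TangentSpace I x} :
    J x v = 0 ↔ v = 0 :=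
  (J.injective x).eq_iff' (map_zero _)

/-- `J x v ≠ v` for `v ≠ 0`: a complex structure has no real eigenvector (characteristic `0`).
[folklore] -/
theorem map_ne_self (J : AlmostComplexStructure I n M) (x : M) {v : TangentSpace I x}
    (hv : v ≠ 0) : J x v ≠ v := by
  intro h
  have h2 : J x (J x v) = v := by rw [h, h]
  rw [J.map_map] at h2
  have h3 : (2 : ℝ) • v = 0 := by
    rw [two_smul]
    nth_rewrite 1 [← h2]
    exact neg_add_cancel v
  exact hv (by simpa using h3)

/-- `J x` as a continuous linear automorphism of `T_x M`, with inverse `-J x` ("an automorphism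
`J : TM → TM`", McDuff–Salamon (2017), §4.1). [cite: McDuffSalamon2017, §4.1] -/
def toContinuousLinearEquiv (J : AlmostComplexStructure I n M) (x : M) :
    TangentSpace I x ≃L[ℝ] TangentSpace I x where
  toLinearMap := (J x : TangentSpace I x →L[ℝ] TangentSpace I x).toLinearMap
  invFun v := -J x v
  left_inv v := by simp
  right_inv v := by simp
  continuous_toFun := (J x).continuous
  continuous_invFun := (J x).continuous.neg

/-- The automorphism `toContinuousLinearEquiv` is `J x`. [folklore] -/
@[simp]
theorem toContinuousLinearEquiv_apply (J : AlmostComplexStructure I n M) (x : M)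
    (v : TangentSpace I x) : J.toContinuousLinearEquiv x v = J x v :=
  rfl

/-- The inverse of `J x` is `-J x`. [folklore] -/
@[simp]
theorem toContinuousLinearEquiv_symm_apply (J : AlmostComplexStructure I n M) (x : M)
    (v : TangentSpace I x) : (J.toContinuousLinearEquiv x).symm v = -J x v :=
  rfl

/-- **An almost complex manifold has even dimension**: if `M` carries an almost complex structure
and has a point, the (finite) dimension of the model space is even — `det(J x)² = det(-id) =
(-1)^{dim}`. McDuff–Salamon (2017), §2.5 ("`V` is necessarily of even dimension over the reals")
and §4.1 ("every almost complex manifold … has even dimension"). [cite: McDuffSalamon2017, §2.5] -/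
theorem even_finrank [FiniteDimensional ℝ E] (J : AlmostComplexStructure I n M) (x : M) :
    Even (Module.finrank ℝ E) := by
  set L : TangentSpace I x →ₗ[ℝ] TangentSpace I x :=
    (J x : TangentSpace I x →L[ℝ] TangentSpace I x).toLinearMap with hL
  have hLL : L ∘ₗ L = (-1 : ℝ) • LinearMap.id := by
    ext v
    simp [hL]
  have hdet : LinearMap.det L * LinearMap.det L = (-1 : ℝ) ^ Module.finrank ℝ E := by
    rw [← LinearMap.det_comp, hLL, LinearMap.det_smul, LinearMap.det_id, mul_one]
    rfl
  rcases Nat.even_or_odd (Module.finrank ℝ E) with h | h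
  · exact h
  · exfalso
    rw [h.neg_one_pow] at hdet
    nlinarith [mul_self_nonneg (LinearMap.det L)]

/-! ### Weakening the regularity; the conjugate structure -/

/-- A `C^n` almost complex structure is `C^{n'}` for `n' ≤ n`. [folklore] -/
def ofLE {n' : WithTop ℕ∞} (J : AlmostComplexStructure I n M) (h : n' ≤ n) :
    AlmostComplexStructure I n' M where
  toFun := J
  map_map' := J.map_map'
  contMDiff' := J.contMDiff.of_le h

/-- `ofLE` does not change the operators. [folklore] -/
@[simp]
theorem ofLE_apply {n' : WithTop ℕ∞} (J : AlmostComplexStructure I n M) (h : n' ≤ n) (x : M) :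
    J.ofLE h x = J x :=
  rfl

/-- The **conjugate** almost complex structure `-J` (again `C^n`, `(-J)² = J² = -1`); reversing
`J` exchanges holomorphic and anti-holomorphic maps (`isAntiHolomorphicMap_iff_neg` in the
companion file `AlmostComplexStructureMaps.lean`). McDuff–Salamon (2017), §2.5 (`J ↦ -J`, cf. the
two components of `𝒥(ℝ²ⁿ)` for odd `n`). [cite: McDuffSalamon2017, §2.5] -/
instance instNeg : Neg (AlmostComplexStructure I n M) where
  neg J :=
    { toFun := fun x ↦ -J x
      map_map' := fun x v ↦ by simp
      contMDiff' := J.contMDiff.neg_section }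

/-- `(-J) x = -(J x)`. [folklore] -/
@[simp]
protected theorem neg_apply (J : AlmostComplexStructure I n M) (x : M) : (-J) x = -J x := rfl

/-- Conjugation is an involution: `-(-J) = J`. [folklore] -/
instance instInvolutiveNeg : InvolutiveNeg (AlmostComplexStructure I n M) where
  neg_neg J := ext fun x v ↦ by simp

/-! ### `ω`-tame and `ω`-compatible almost complex structures -/

section Tame

/-- Antisymmetry of a `2`-form on a pair of vectors. [folklore] -/
private theorem twoForm_swap {V : Type*} [AddCommGroup V] [Module ℝ V] [TopologicalSpace V]
    (A : V [⋀^Fin 2]→L[ℝ] ℝ) (v w : V) : A ![v, w] = -A ![w, v] := by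
  classical
  have h := A.map_swap ![w, v] (show (0 : Fin 2) ≠ 1 by decide)
  have hv : (![w, v] ∘ Equiv.swap (0 : Fin 2) 1) = ![v, w] := by
    funext i
    fin_cases i <;> rfl
  rw [hv] at h
  exact h

/-- Homogeneity of a `2`-form in its first argument. [folklore] -/
private theorem twoForm_smul_left {V : Type*} [AddCommGroup V] [Module ℝ V] [TopologicalSpace V]
    (A : V [⋀^Fin 2]→L[ℝ] ℝ) (c : ℝ) (v w : V) : A ![c • v, w] = c • A ![v, w] :=
  A.vecCons_smul _ _ _

/-- A `2`-form is odd in its second argument. [folklore] -/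
private theorem twoForm_neg_right {V : Type*} [AddCommGroup V] [Module ℝ V] [TopologicalSpace V]
    (A : V [⋀^Fin 2]→L[ℝ] ℝ) (v w : V) : A ![v, -w] = -A ![v, w] := by
  rw [twoForm_swap A v (-w), twoForm_swap A v w, neg_neg, ← neg_one_smul ℝ w, twoForm_smul_left,
    neg_one_smul, neg_neg]

/-- **`ω`-tame** almost complex structure (Gromov): `J` is tamed by the `2`-form `σ` if
`σ(v, Jv) > 0` for every nonzero tangent vector `v`. McDuff–Salamon (2017), §4.1, (4.1.1);
Remark 4.1.2 (terminology due to Gromov 1985). [cite: McDuffSalamon2017, §4.1 (4.1.1)] -/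
def IsTamedBy (J : AlmostComplexStructure I n M) (σ : Kaehler.MForm I M ℝ 2) : Prop :=
  ∀ (x : M) (v : TangentSpace I x), v ≠ 0 → 0 < σ x ![v, J x v]

/-- **`ω`-compatible** almost complex structure: `J` is tamed by `σ` and `σ` is `J`-invariant,
`σ(Jv, Jw) = σ(v, w)`; equivalently (`isCompatibleWith_iff`) `⟨v, w⟩ := σ(v, Jw)` is a
Riemannian metric. McDuff–Salamon (2017), §4.1, (4.1.2)–(4.1.3). [cite: McDuffSalamon2017, §4.1 (4.1.2)] -/
structure IsCompatibleWith (J : AlmostComplexStructure I n M) (σ : Kaehler.MForm I M ℝ 2) :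
    Prop where
  /-- (4.1.1): `σ(v, Jv) > 0` for `v ≠ 0` -/
  isTamedBy : J.IsTamedBy σ
  /-- (4.1.2): `σ(Jv, Jw) = σ(v, w)` -/
  map_map (x : M) (v w : TangentSpace I x) : σ x ![J x v, J x w] = σ x ![v, w]

variable {J : AlmostComplexStructure I n M} {σ : Kaehler.MForm I M ℝ 2}

/-- Unfolding `IsTamedBy`. [folklore] -/
theorem isTamedBy_iff :
    J.IsTamedBy σ ↔ ∀ (x : M) (v : TangentSpace I x), v ≠ 0 → 0 < σ x ![v, J x v] :=
  Iff.rfl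

/-- A taming form is positive on `(v, Jv)`, `v ≠ 0` (McDuff–Salamon (2017), (4.1.1)). [cite: McDuffSalamon2017, §4.1 (4.1.1)] -/
theorem IsTamedBy.pos (h : J.IsTamedBy σ) (x : M) {v : TangentSpace I x} (hv : v ≠ 0) :
    0 < σ x ![v, J x v] :=
  h x v hv

/-- `σ(v, Jv) ≥ 0` for a taming form. [folklore] -/
theorem IsTamedBy.nonneg (h : J.IsTamedBy σ) (x : M) (v : TangentSpace I x) :
    0 ≤ σ x ![v, J x v] := by
  by_cases hv : v = 0
  · subst hv
    have : (![(0 : TangentSpace I x), J x 0] : Fin 2 → TangentSpace I x) = 0 := by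
      funext i; fin_cases i <;> simp
    rw [this, (σ x).map_zero]
  · exact (h x v hv).le

/-- **A taming form is nondegenerate**: if `σ(v, w) = 0` for all `w` then `v = 0` (take
`w = Jv`). McDuff–Salamon (2017), §4.1 (taming/compatibility is asked of nondegenerate `2`-forms;
conversely (4.1.1) forces nondegeneracy). [cite: McDuffSalamon2017, §4.1] -/
theorem IsTamedBy.eq_zero_of_forall (h : J.IsTamedBy σ) (x : M) {v : TangentSpace I x}
    (hv : ∀ w : TangentSpace I x, σ x ![v, w] = 0) : v = 0 := by
  by_contra hne
  exact (h x v hne).ne' (hv (J x v))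

/-- The conjugate structure `-J` is tamed by `-σ`. [folklore] -/
theorem IsTamedBy.neg (h : J.IsTamedBy σ) : (-J).IsTamedBy (-σ) := by
  intro x v hv
  have h1 := h x v hv
  change 0 < -(σ x ![v, -(J x v)])
  rw [twoForm_neg_right, neg_neg]
  exact h1

/-- A compatible structure is tame (McDuff–Salamon (2017), §4.1: `𝒥(M, ω) ⊆ 𝒥_τ(M, ω)`). [cite: McDuffSalamon2017, §4.1] -/
theorem IsCompatibleWith.pos (h : J.IsCompatibleWith σ) (x : M) {v : TangentSpace I x}
    (hv : v ≠ 0) : 0 < σ x ![v, J x v] :=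
  h.isTamedBy x v hv

/-- For a compatible structure the bilinear form `g_J(v, w) := σ(v, Jw)` is **symmetric**
(McDuff–Salamon (2017), (4.1.3)). [cite: McDuffSalamon2017, §4.1 (4.1.3)] -/
theorem IsCompatibleWith.symm (h : J.IsCompatibleWith σ) (x : M) (v w : TangentSpace I x) :
    σ x ![v, J x w] = σ x ![w, J x v] := by
  have h1 := h.map_map x v (J x w)
  rw [J.map_map, twoForm_neg_right] at h1
  rw [← h1, twoForm_swap, neg_neg]

/-- For a compatible structure, `σ(Jv, w) = -σ(v, Jw)` (`J` is `σ`-skew). [cite: McDuffSalamon2017, §4.1 (4.1.2)] -/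
theorem IsCompatibleWith.map_left (h : J.IsCompatibleWith σ) (x : M) (v w : TangentSpace I x) :
    σ x ![J x v, w] = -σ x ![v, J x w] := by
  have h1 := h.map_map x v (J x w)
  rw [J.map_map, twoForm_neg_right] at h1
  rw [← h1, neg_neg]

/-- The conjugate of a compatible structure is compatible with `-σ`. [folklore] -/
theorem IsCompatibleWith.neg (h : J.IsCompatibleWith σ) : (-J).IsCompatibleWith (-σ) where
  isTamedBy := h.isTamedBy.neg
  map_map x v w := by
    change -(σ x ![-(J x v), -(J x w)]) = -(σ x ![v, w])
    rw [twoForm_neg_right, twoForm_swap (σ x) (-(J x v)), twoForm_neg_right, neg_neg, neg_neg,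
      h.map_map, twoForm_swap (σ x) w v]

/-- **Compatibility criterion** (McDuff–Salamon (2017), after (4.1.2): "`J` is compatible with `ω`
if and only if the bilinear form `⟨v, w⟩ := ω(v, Jw)` … defines a Riemannian metric"): `J` is
`σ`-compatible iff `g_J(v, w) := σ(v, Jw)` is symmetric and positive definite on every tangent
space. [cite: McDuffSalamon2017, §4.1 (4.1.3)] -/
theorem isCompatibleWith_iff :
    J.IsCompatibleWith σ ↔
      (∀ (x : M) (v w : TangentSpace I x), σ x ![v, J x w] = σ x ![w, J x v]) ∧
        ∀ (x : M) (v : TangentSpace I x), v ≠ 0 → 0 < σ x ![v, J x v] := by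
  constructor
  · exact fun h ↦ ⟨h.symm, h.isTamedBy⟩
  · rintro ⟨hsymm, hpos⟩
    refine ⟨hpos, fun x v w ↦ ?_⟩
    rw [hsymm x (J x v) w, J.map_map, twoForm_neg_right, ← twoForm_swap]

end Tame

/-! ### Examples: constant structures on the model space; `ℂⁿ` -/

section Model

variable (I n) in
/-- A **constant** almost complex structure on the model space `H` of `I`: a linear complex
structure `J₀` of `E` (`J₀² = -1`) placed on every tangent space `TangentSpace I x = E`. It is a
`C^n` section for every `n` because the tangent bundle of the model space is trivialised by the
identity (`inCoordinates_tangent_bundle_core_model_space`). McDuff–Salamon (2017), §2.5 (linear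
complex structures) and §1.1 ("the vector space `ℝ²ⁿ` viewed as the tangent space of the manifold
`ℝ²ⁿ`"). [cite: McDuffSalamon2017, §2.5] -/
def ofModel (J₀ : E →L[ℝ] E) (hJ₀ : ∀ v, J₀ (J₀ v) = -v) : AlmostComplexStructure I n H where
  toFun _ := J₀
  map_map' _ v := hJ₀ v
  contMDiff' := by
    intro x₀
    rw [contMDiffAt_hom_bundle]
    refine ⟨contMDiffAt_id, ?_⟩
    simp only [inCoordinates_tangent_bundle_core_model_space]
    exact contMDiffAt_const

/-- `ofModel` is the constant field `J₀` (deliberately not `@[simp]`: unfolding `J` would break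
the simp-normal form `map_map`). [folklore] -/
theorem ofModel_apply (J₀ : E →L[ℝ] E) (hJ₀ : ∀ v, J₀ (J₀ v) = -v) (x : H) :
    ofModel I n J₀ hJ₀ x = J₀ :=
  rfl

variable (n) in
/-- The **standard complex structure `J₀`** of a complex normed space `E` (e.g. `ℂⁿ`), regarded as
the real manifold `E` modelled on itself: multiplication by `i` on every tangent space
(McDuff–Salamon (2017), §2.5: "the matrix `J₀` corresponds to multiplication by `i`" under
`ℝ²ⁿ ≅ ℂⁿ`). On a complex manifold this is `Literature.Geometry.Kaehler.tangentJ` pointwise. [cite: McDuffSalamon2017, §2.5] -/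
def standard (E : Type*) [NormedAddCommGroup E] [NormedSpace ℂ E] :
    AlmostComplexStructure 𝓘(ℝ, E) n E :=
  ofModel 𝓘(ℝ, E) n ((Complex.I • ContinuousLinearMap.id ℂ E).restrictScalars ℝ) fun v ↦ by
    simp [smul_smul]

/-- `J₀ v = i • v` (the scalar action of `E`; `TangentSpace 𝓘(ℝ, E) x = E`; not `@[simp]`, like
`Literature.Geometry.Kaehler.tangentJ_apply`). [cite: McDuffSalamon2017, §2.5] -/
theorem standard_apply {E : Type*} [NormedAddCommGroup E] [NormedSpace ℂ E] (x : E)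
    (v : TangentSpace 𝓘(ℝ, E) x) :
    standard n E x v = HSMul.hSMul (β := E) (γ := E) Complex.I v :=
  rfl

end Model

end AlmostComplexStructure

end Literature.Geometry.Symplectic

end
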